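import Literature.AlgebraicGeometry.Resolution.BlowupChartRsop
import Literature.AlgebraicGeometry.Resolution.BlowupChartRegular
import Literature.AlgebraicGeometry.Resolution.BlowupAlgebraDerivations
import Literature.AlgebraicGeometry.Resolution.MvPolynomialKillVars
import HarnessLib

/-!
# The affine blowup algebra of a quasi-regular sequence modulo the exceptional divisor; primes of `Λ[T]` generated by variables and constants

Topic: `Literature/AlgebraicGeometry/Resolution`. Two generic bricks for the chart computation of
de Jong 1996, 4.27 (the blow-up of `k⟦u, v, t⟧/(uv - t₁ ⋯ t_s)` in `(u, v, t₁, t₂)`, p. 76),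
both PROVED for arbitrary commutative rings:

* For a sequence `c = (c₁, …, c_n)` in `R`, `I = (c)`, and the affine blowup algebra
  `T = R[I/cᵢ] ⊆ R[1/cᵢ]` (image model `blowupAlgebra`, `AffineBlowupAlgebra.lean`):
  `reesChartEquiv_chartGen` (the chart isomorphism `(R[It])_{(cᵢt)} ≅ R[I/cᵢ]` sends
  `e_j = (c_j t)/(cᵢ t)` to the generator `c_j/cᵢ`), `isNoetherianRing_blowupAlgebra`,
  `isRegularRing_blowupAlgebra` (`R` regular, `c` quasi-regular, `R/I` regular ⇒ `R[I/cᵢ]`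
  regular; transported from `isRegularRing_blowupChart`, Liu Thm. 8.1.19 (a) on the charts), and
  **`blowupAlgebraQuotEquiv`: `(R/I)[T_j : j ≠ i] ≅ R[I/cᵢ]/(cᵢ)` EXPLICITLY**, `T_j ↦ c_j/cᵢ`,
  `r̄ ↦ r/1` (`blowupAlgebraQuotEquiv_X`, `blowupAlgebraQuotEquiv_C`), for `c` quasi-regular
  (transported from `chartQuotEquiv` of `BlowupChartRsop.lean`, Stacks 0BIQ).
* For a ring `Λ`, an ideal `𝔟 ⊆ Λ` and a set `K` of variables: the ideal
  `(T_j : j ∈ K) + 𝔟 Λ[T]` of `Λ[T_σ]` is the kernel of `Λ[T_σ] → (Λ/𝔟)[T_σ]/(T_j : j ∈ K)`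
  (`MvPolynomial.ker_quotient_comp_map_eq`), hence prime when `𝔟` is
  (`MvPolynomial.isPrime_span_X_image_sup_map_C`); a variable `T_j`, `j ∉ K`, and a constant
  `r ∉ 𝔟` do not lie in it (`X_notMem_…`, `C_notMem_…`). These are the primes
  `(x', y', z', t_c)`, `(x', y', t_c, t_{c'})` of the exceptional chart `(A/𝔭)[x', y', z']` through
  which the strict transforms of the `V(𝔭_{ab})` are located.

## Sources

* The Stacks Project, Tag 0BIQ (affine blowup algebra of a regular sequence), Tag 0804, via
  `BlowupChartRsop.lean`, `BlowupChartQuasiRegular.lean`. [StacksProject]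
* Q. Liu, *Algebraic Geometry and Arithmetic Curves* (2002), Thm. 8.1.19 (a), via
  `BlowupChartRegular.lean`. [Liu2002]
-/

noncomputable section

open IsLocalRing HomogeneousLocalization IsLocalization

namespace Literature.AlgebraicGeometry.Resolution

universe u v

/-! ## The affine blowup algebra `R[I/cᵢ]` of a sequence: transport from the chart ring -/

section Chart

variable {R : Type u} [CommRing R] {n : ℕ} (c : Fin n → R) (i : Fin n)

local notation3 "I" => Ideal.span (Set.range c)

/-- The chart isomorphism `(R[It])_{(cᵢt)} ≅ R[I/cᵢ]` sends the generator `e_j = (c_j t)/(cᵢ t)`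
to `c_j/cᵢ`. [folklore] -/
theorem reesChartEquiv_chartGen (j : Fin n) :
    reesChartEquiv (c i) (Ideal.mem_span_range_self (f := c) (x := i)) (chartGen c i j) =
      blowupAlgebra.gen I (c i) (c j) (Ideal.mem_span_range_self (f := c) (x := j)) := by
  apply Subtype.ext
  rw [coe_reesChartEquiv, blowupAlgebra.coe_gen,
    reesChart_mk (c i) _ (reesT_mem_one_smul c j) (r := c j) (coe_reesT _ _), pow_one]

/-- `R[I/cᵢ]` is Noetherian if `R` is. [folklore] -/
theorem isNoetherianRing_blowupAlgebra [IsNoetherianRing R] :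
    IsNoetherianRing (blowupAlgebra I (c i)) :=
  haveI := isNoetherianRing_blowupChart c i
  isNoetherianRing_of_ringEquiv (chartRing c i)
    (reesChartEquiv (c i) (Ideal.mem_span_range_self (f := c) (x := i)))

/-- **`R[I/cᵢ]` is a regular ring** for `R` regular, `c` quasi-regular and `R/(c)` regular (the
charts of the blowing up of a regular scheme along a regular centre are regular, Liu
Thm. 8.1.19 (a); `isRegularRing_blowupChart` transported along `(R[It])_{(cᵢt)} ≅ R[I/cᵢ]`).
[cite: Liu2002, Thm. 8.1.19 (a) (affine charts)] -/
theorem isRegularRing_blowupAlgebra [IsRegularRing R] (hc : IsQuasiRegular c)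
    [IsRegularRing (R ⧸ I)] : IsRegularRing (blowupAlgebra I (c i)) :=
  haveI := isRegularRing_blowupChart c i hc
  IsRegularRing.of_ringEquiv (R := chartRing c i)
    (reesChartEquiv (c i) (Ideal.mem_span_range_self (f := c) (x := i)))

/-- The image of the exceptional ideal under the chart isomorphism: `(φ cᵢ) ↦ (cᵢ/1)`. [folklore] -/
theorem map_reesChartEquiv_span_chartBase :
    Ideal.span {algebraMap R (blowupAlgebra I (c i)) (c i)} =
      (Ideal.span {chartBase c i (c i)}).map
        (reesChartEquiv (c i) (Ideal.mem_span_range_self (f := c) (x := i)) :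
          chartRing c i →+* blowupAlgebra I (c i)) := by
  rw [Ideal.map_span, Set.image_singleton]
  congr 2
  exact (reesChartEquiv_reesChartBase (c i) _ (c i)).symm

/-- **`(R/I)[T_j : j ≠ i] ≅ R[I/cᵢ]/(cᵢ)` for `c` quasi-regular**, explicitly: `T_j ↦ c_j/cᵢ`,
`r̄ ↦ r/1` — the affine blowup algebra of a quasi-regular sequence modulo the exceptional divisor
is a polynomial ring over the centre (Stacks 0BIQ reduced modulo `cᵢ`; `chartQuotEquiv`
transported along `(R[It])_{(cᵢt)} ≅ R[I/cᵢ]`). [cite: StacksProject, Tag 0BIQ] -/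
def blowupAlgebraQuotEquiv (hc : IsQuasiRegular c) :
    MvPolynomial {j : Fin n // j ≠ i} (R ⧸ I) ≃+*
      blowupAlgebra I (c i) ⧸ Ideal.span {algebraMap R (blowupAlgebra I (c i)) (c i)} :=
  (chartQuotEquiv c i hc).trans
    (Ideal.quotientEquiv _ _ (reesChartEquiv (c i) (Ideal.mem_span_range_self (f := c) (x := i)))
      (map_reesChartEquiv_span_chartBase c i))

/-- `blowupAlgebraQuotEquiv` on constants: `r̄ ↦ r/1 mod cᵢ`. [folklore] -/
theorem blowupAlgebraQuotEquiv_C (hc : IsQuasiRegular c) (r : R) :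
    blowupAlgebraQuotEquiv c i hc (MvPolynomial.C (Ideal.Quotient.mk I r)) =
      Ideal.Quotient.mk _ (algebraMap R (blowupAlgebra I (c i)) r) := by
  rw [blowupAlgebraQuotEquiv, RingEquiv.trans_apply, chartQuotEquiv_apply, chartQuotMap_C,
    Ideal.quotientEquiv_mk, reesChartEquiv_reesChartBase]

/-- `blowupAlgebraQuotEquiv` on variables: `T_j ↦ c_j/cᵢ mod cᵢ`. [folklore] -/
theorem blowupAlgebraQuotEquiv_X (hc : IsQuasiRegular c) (j : {j : Fin n // j ≠ i}) :
    blowupAlgebraQuotEquiv c i hc (MvPolynomial.X j) =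
      Ideal.Quotient.mk _ (blowupAlgebra.gen I (c i) (c j.1)
        (Ideal.mem_span_range_self (f := c) (x := j.1))) := by
  rw [blowupAlgebraQuotEquiv, RingEquiv.trans_apply, chartQuotEquiv_apply, chartQuotMap_X,
    Ideal.quotientEquiv_mk, reesChartEquiv_chartGen]

/-- `blowupAlgebraQuotEquiv` after reducing coefficients is `(mod cᵢ) ∘ (T_j ↦ c_j/cᵢ)`.
[folklore] -/
theorem blowupAlgebraQuotEquiv_map (hc : IsQuasiRegular c) (p : MvPolynomial {j : Fin n // j ≠ i} R) :
    blowupAlgebraQuotEquiv c i hc (MvPolynomial.map (Ideal.Quotient.mk I) p) =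
      Ideal.Quotient.mk _ (MvPolynomial.eval₂Hom (algebraMap R (blowupAlgebra I (c i)))
        (fun j => blowupAlgebra.gen I (c i) (c j.1)
          (Ideal.mem_span_range_self (f := c) (x := j.1))) p) := by
  induction p using MvPolynomial.induction_on with
  | C r => rw [MvPolynomial.map_C, blowupAlgebraQuotEquiv_C, MvPolynomial.eval₂Hom_C]
  | add p q hp hq => rw [map_add, map_add, hp, hq, map_add, map_add]
  | mul_X p j hp =>
    rw [map_mul, map_mul, hp, MvPolynomial.map_X, blowupAlgebraQuotEquiv_X, map_mul,
      MvPolynomial.eval₂Hom_X', map_mul]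

end Chart

/-! ## Primes of `Λ[T_σ]` generated by variables and constants -/

namespace MvPolynomial

open _root_.MvPolynomial

variable {σ : Type u} {Λ : Type v} [CommRing Λ] (K : Set σ) (𝔟 : Ideal Λ)

/-- **The kernel of `Λ[T_σ] → (Λ/𝔟)[T_σ]/(T_j : j ∈ K)`** (reduce coefficients, then kill the
variables of `K`) is `(T_j : j ∈ K) + 𝔟·Λ[T_σ]`. [folklore] -/
theorem ker_quotient_comp_map_eq :
    RingHom.ker ((Ideal.Quotient.mk (Ideal.span (X '' K : Set (MvPolynomial σ (Λ ⧸ 𝔟))))).comp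
        (map (Ideal.Quotient.mk 𝔟))) =
      Ideal.span (X '' K : Set (MvPolynomial σ Λ)) ⊔ 𝔟.map (C : Λ →+* MvPolynomial σ Λ) := by
  have hsurj : Function.Surjective (map (σ := σ) (Ideal.Quotient.mk 𝔟)) :=
    map_surjective _ Ideal.Quotient.mk_surjective
  have himg : Ideal.span (X '' K : Set (MvPolynomial σ (Λ ⧸ 𝔟))) =
      (Ideal.span (X '' K : Set (MvPolynomial σ Λ))).map (map (Ideal.Quotient.mk 𝔟)) := by
    rw [Ideal.map_span, Set.image_image]
    congr 1
    refine Set.image_congr fun j _ => ?_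
    rw [map_X]
  rw [← RingHom.comap_ker, Ideal.mk_ker, himg, Ideal.comap_map_of_surjective _ hsurj,
    ← RingHom.ker_eq_comap_bot, _root_.MvPolynomial.ker_map, Ideal.mk_ker]

/-- The map `Λ[T_σ] → (Λ/𝔟)[T_σ]/(T_j : j ∈ K)` is surjective. [folklore] -/
theorem quotient_comp_map_surjective :
    Function.Surjective ((Ideal.Quotient.mk (Ideal.span (X '' K : Set (MvPolynomial σ (Λ ⧸ 𝔟))))).comp
      (map (Ideal.Quotient.mk 𝔟))) :=
  Ideal.Quotient.mk_surjective.comp (map_surjective _ Ideal.Quotient.mk_surjective)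

/-- **`(T_j : j ∈ K) + 𝔟·Λ[T_σ]` is prime for `𝔟` prime** (the quotient is
`(Λ/𝔟)[T_j : j ∉ K]`, a domain). [folklore] -/
theorem isPrime_span_X_image_sup_map_C [𝔟.IsPrime] :
    (Ideal.span (X '' K : Set (MvPolynomial σ Λ)) ⊔ 𝔟.map (C : Λ →+* MvPolynomial σ Λ)).IsPrime := by
  haveI : IsDomain (MvPolynomial σ (Λ ⧸ 𝔟) ⧸ Ideal.span (X '' K : Set (MvPolynomial σ (Λ ⧸ 𝔟)))) :=
    isDomain_quotient_span_X K
  rw [← ker_quotient_comp_map_eq]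
  exact RingHom.ker_isPrime _

/-- A variable outside `K` does not lie in `(T_j : j ∈ K) + 𝔟·Λ[T_σ]` (for `𝔟 ≠ Λ`). [folklore] -/
theorem X_notMem_span_X_image_sup_map_C (h𝔟 : 𝔟 ≠ ⊤) {j : σ} (hj : j ∉ K) :
    (X j : MvPolynomial σ Λ) ∉
      Ideal.span (X '' K : Set (MvPolynomial σ Λ)) ⊔ 𝔟.map (C : Λ →+* MvPolynomial σ Λ) := by
  haveI : Nontrivial (Λ ⧸ 𝔟) := Ideal.Quotient.nontrivial_iff.mpr h𝔟
  rw [← ker_quotient_comp_map_eq, RingHom.mem_ker, RingHom.comp_apply, map_X,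
    Ideal.Quotient.eq_zero_iff_mem]
  exact X_not_mem_span_X K hj

/-- A constant outside `𝔟` does not lie in `(T_j : j ∈ K) + 𝔟·Λ[T_σ]`. [folklore] -/
theorem C_notMem_span_X_image_sup_map_C {r : Λ} (hr : r ∉ 𝔟) :
    (C r : MvPolynomial σ Λ) ∉
      Ideal.span (X '' K : Set (MvPolynomial σ Λ)) ⊔ 𝔟.map (C : Λ →+* MvPolynomial σ Λ) := by
  rw [← ker_quotient_comp_map_eq, RingHom.mem_ker, RingHom.comp_apply, map_C,
    Ideal.Quotient.eq_zero_iff_mem]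
  intro h
  have h0 : Ideal.Quotient.mk (Ideal.span (X '' K : Set (MvPolynomial σ (Λ ⧸ 𝔟))))
      (C (Ideal.Quotient.mk 𝔟 r)) = 0 := Ideal.Quotient.eq_zero_iff_mem.mpr h
  have h1 := quotientSpanXEquiv_mk_C (R := Λ ⧸ 𝔟) K (Ideal.Quotient.mk 𝔟 r)
  rw [h0, map_zero] at h1
  have h2 : (Ideal.Quotient.mk 𝔟 r) = 0 := by
    have := congrArg (coeff 0) h1
    simpa using this.symm
  exact hr (Ideal.Quotient.eq_zero_iff_mem.mp h2)

/-- Membership of the generators: `T_j ∈ (T_j : j ∈ K) + 𝔟·Λ[T_σ]` for `j ∈ K`. [folklore] -/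
theorem X_mem_span_X_image_sup_map_C {j : σ} (hj : j ∈ K) :
    (X j : MvPolynomial σ Λ) ∈
      Ideal.span (X '' K : Set (MvPolynomial σ Λ)) ⊔ 𝔟.map (C : Λ →+* MvPolynomial σ Λ) :=
  Ideal.mem_sup_left (Ideal.subset_span ⟨j, hj, rfl⟩)

/-- Membership of the generators: `C r ∈ (T_j : j ∈ K) + 𝔟·Λ[T_σ]` for `r ∈ 𝔟`. [folklore] -/
theorem C_mem_span_X_image_sup_map_C {r : Λ} (hr : r ∈ 𝔟) :
    (C r : MvPolynomial σ Λ) ∈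
      Ideal.span (X '' K : Set (MvPolynomial σ Λ)) ⊔ 𝔟.map (C : Λ →+* MvPolynomial σ Λ) :=
  Ideal.mem_sup_right (Ideal.mem_map_of_mem _ hr)

/-- **Strict growth in the variables**: for `j ∉ K` (and `𝔟 ≠ Λ`),
`(T_l : l ∈ K) + 𝔟 Λ[T] < (T_l : l ∈ K ∪ {j}) + 𝔟 Λ[T]`. [folklore] -/
theorem span_X_image_sup_map_C_lt_insert (h𝔟 : 𝔟 ≠ ⊤) {j : σ} (hj : j ∉ K) :
    Ideal.span (X '' K : Set (MvPolynomial σ Λ)) ⊔ 𝔟.map (C : Λ →+* MvPolynomial σ Λ) <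
      Ideal.span (X '' insert j K : Set (MvPolynomial σ Λ)) ⊔ 𝔟.map (C : Λ →+* MvPolynomial σ Λ) := by
  refine lt_of_le_of_ne (sup_le_sup_right (Ideal.span_mono (Set.image_mono (Set.subset_insert j K))) _)
    fun h => ?_
  have hmem : (X j : MvPolynomial σ Λ) ∈
      Ideal.span (X '' insert j K : Set (MvPolynomial σ Λ)) ⊔ 𝔟.map (C : Λ →+* MvPolynomial σ Λ) :=
    X_mem_span_X_image_sup_map_C _ 𝔟 (Set.mem_insert j K)
  rw [← h] at hmem
  exact X_notMem_span_X_image_sup_map_C K 𝔟 h𝔟 hj hmem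

/-- **Strict growth in the constants**: for ideals `𝔟 ≤ 𝔟'` and `r ∈ 𝔟' ∖ 𝔟`,
`(T_l : l ∈ K) + 𝔟 Λ[T] < (T_l : l ∈ K) + 𝔟' Λ[T]`. [folklore] -/
theorem span_X_image_sup_map_C_lt_of_lt {𝔟' : Ideal Λ} (hle : 𝔟 ≤ 𝔟') {r : Λ} (hr : r ∈ 𝔟')
    (hr' : r ∉ 𝔟) :
    Ideal.span (X '' K : Set (MvPolynomial σ Λ)) ⊔ 𝔟.map (C : Λ →+* MvPolynomial σ Λ) <
      Ideal.span (X '' K : Set (MvPolynomial σ Λ)) ⊔ 𝔟'.map (C : Λ →+* MvPolynomial σ Λ) := by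
  refine lt_of_le_of_ne (sup_le_sup_left (Ideal.map_mono hle) _) fun h => ?_
  have hmem : (C r : MvPolynomial σ Λ) ∈
      Ideal.span (X '' K : Set (MvPolynomial σ Λ)) ⊔ 𝔟'.map (C : Λ →+* MvPolynomial σ Λ) :=
    C_mem_span_X_image_sup_map_C K 𝔟' hr
  rw [← h] at hmem
  exact C_notMem_span_X_image_sup_map_C K 𝔟 hr' hmem

end MvPolynomial

end Literature.AlgebraicGeometry.Resolution

end
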